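import Summits.MatrixMultiplication.MatrixMultiplication.Theorems.ObstructionDescentUniversalOccurrenceTwoRectanglePairTableaux

set_option linter.dupNamespace false
set_option autoImplicit false

/-!
# Universal occurrence — two rectangles and TWO COLUMN PAIRS, part B: colour counts and the local alphabet (decomp-mm · lens 3 · gen 43)

Route `route-MatrixMultiplication-ObstructionDescent` (sub-problem `MatrixMultiplication`, `ω(ℂ) = 2`); SUPPORT for the crux
`NoOccurrenceObstruction` (`P_O`, item `stmt-MatrixMultiplication-29040`) through the universal-occurrence programme (NODE-g29…g43
of the decomp-mm cell, lens 3).  Nothing here proves `ω = 2` or closes an item; no `def`, no `sorry`, standard axioms.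

**This file (arithmetic only).**  `sum_core_eq`: a function on the slots vanishing beyond slot `4` sums to its five core values (used
in part C to read off the colour content `{0,0,1,1,2}` of each block from `∑_i g(i) = 4`).  `twoPairs_local_configurations`: the
finite LOCAL ALPHABET of the two-pair twist design of part C — a valid support configuration (columns `(A₀,B₀,A₁) ‖ (B₂,A₂,B₁)` and
`(A₃,B₃) ‖ (B₄,A₄)`, injective columns with small letters, `B₁ = A₁`, colour content `{0,0,1,1,2}` per block) has twin columns in
both pairs, or both pairs reversed ("anti-twins"; exactly two configurations, each an even column swap of a twin word).  This is the
`k = 1` instance of the parity law of NODE-g43 §3: the sign of a configuration is `∏_pairs (-1)^{D₀/2} = +1`.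

[cite: BurgisserIkenmeyer2011, §3.4 (Prop. 3.4), Thm. 4.4] [cite: BurgisserIkenmeyer2017, §5, Thm. 5.9 (proof of (2)), eq. (3.4)]
-/

noncomputable section

open scoped BigOperators

namespace Summit.MatrixMultiplication.MatrixMultiplication.Theorems.ObstructionCalculus

/-! ### §1 Counting colours on the core -/

/-- A function on the slots vanishing beyond slot `4` sums to its five core values. [folklore] -/
theorem sum_core_eq {N : ℕ} (a : Fin N → ℕ) (s0 s1 s2 s3 s4 : Fin N) (hs0 : (s0 : ℕ) = 0) (hs1 : (s1 : ℕ) = 1)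
    (hs2 : (s2 : ℕ) = 2) (hs3 : (s3 : ℕ) = 3) (hs4 : (s4 : ℕ) = 4) (h : ∀ s : Fin N, 5 ≤ (s : ℕ) → a s = 0) :
    ∑ s, a s = a s0 + a s1 + a s2 + a s3 + a s4 := by
  classical
  have hN : 5 ≤ N := by have := s4.2; omega
  let a' : ℕ → ℕ := fun n => if hn : n < N then a ⟨n, hn⟩ else 0
  have ha' : ∀ s : Fin N, a s = a' s := fun s => by simp [a']
  have h1 : ∑ s : Fin N, a s = ∑ i ∈ Finset.range N, a' i := by
    rw [← Fin.sum_univ_eq_sum_range]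
    exact Finset.sum_congr rfl (fun s _ => ha' s)
  have h2 : ∑ i ∈ Finset.range 5, a' i = ∑ i ∈ Finset.range N, a' i := by
    apply Finset.sum_subset (fun x hx => Finset.mem_range.2 (lt_of_lt_of_le (Finset.mem_range.1 hx) hN))
    intro x hx hx5
    rw [Finset.mem_range] at hx hx5
    simp only [a', dif_pos hx]
    exact h _ (by simp; omega)
  rw [h1, ← h2]
  simp only [Finset.sum_range_succ, Finset.sum_range_zero, zero_add]
  have e0 : a' 0 = a s0 := by
    simp only [a', dif_pos (show 0 < N by omega)]; congr 1; exact Fin.ext (by simp [hs0])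
  have e1 : a' 1 = a s1 := by
    simp only [a', dif_pos (show 1 < N by omega)]; congr 1; exact Fin.ext (by simp [hs1])
  have e2 : a' 2 = a s2 := by
    simp only [a', dif_pos (show 2 < N by omega)]; congr 1; exact Fin.ext (by simp [hs2])
  have e3 : a' 3 = a s3 := by
    simp only [a', dif_pos (show 3 < N by omega)]; congr 1; exact Fin.ext (by simp [hs3])
  have e4 : a' 4 = a s4 := by
    simp only [a', dif_pos (show 4 < N by omega)]; congr 1; exact Fin.ext (by simp [hs4])
  rw [e0, e1, e2, e3, e4]

/-! ### §2 The local alphabet of the two-pair design -/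

set_option maxHeartbeats 400000 in
/-- **Local configurations of the two-pair design.**  Letters of a valid support word on the core: column `0` = `(A₀,B₀,A₁)`,
column `1` = `(B₂,A₂,B₁)`, column `2` = `(A₃,B₃)`, column `3` = `(B₄,A₄)` (`A_i`, `B_i` the colours of the blocks `0`, `1` at
slot `s_i`); columns injective with letters `< 3`, `< 3`, `< 2`, `< 2`; validity at the twisted slot gives `B₁ = A₁`; each block
carries the colour content `{0,0,1,1,2}` on the core (sum `4`, exactly one `2`).  Then the columns of each pair are twins, or both
pairs are reversed ("anti-twins": exactly the two configurations `(0,1,2 ‖ 1,0,2 ‖ 1,0 ‖ 0,1)`, `(1,0,2 ‖ 0,1,2 ‖ 0,1 ‖ 1,0)`, each the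
even swap `(3 4)(8 9)` of a twin word). [folklore] -/
theorem twoPairs_local_configurations (A0 A1 A2 A3 A4 B0 B1 B2 B3 B4 : ℕ)
    (hA0 : A0 < 3) (hB0 : B0 < 3) (hA1 : A1 < 3) (hB2 : B2 < 3) (hA2 : A2 < 3)
    (hB3 : B3 < 2) (hB4 : B4 < 2) (c34 : B2 ≠ A2) (c35 : B2 ≠ B1) (c45 : A2 ≠ B1)
    (c67 : A3 + B3 = 1) (c89 : B4 + A4 = 1) (hH : B1 = A1)
    (hsA : A0 + A1 + A2 + A3 + A4 = 4) (hsB : B0 + B1 + B2 + B3 + B4 = 4)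
    (h2A : A0 = 2 ∨ A1 = 2 ∨ A2 = 2) (h2B : B0 = 2 ∨ B1 = 2 ∨ B2 = 2)
    (xA01 : A0 + A1 ≤ 3) (xA02 : A0 + A2 ≤ 3) (xA12 : A1 + A2 ≤ 3)
    (xB01 : B0 + B1 ≤ 3) (xB02 : B0 + B2 ≤ 3) (xB12 : B1 + B2 ≤ 3) :
    (B2 = A0 ∧ A2 = B0 ∧ B4 = A3 ∧ A4 = B3) ∨ (A2 = A0 ∧ B2 = B0 ∧ A4 = A3 ∧ B4 = B3) := by
  rcases h2A with a | a | a <;> rcases h2B with b | b | b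
  · exfalso; omega
  · exfalso; omega
  · left; exact ⟨by omega, by omega, by omega, by omega⟩
  · exfalso; omega
  · by_cases ht : B2 = A0
    · left; exact ⟨ht, by omega, by omega, by omega⟩
    · right; exact ⟨by omega, by omega, by omega, by omega⟩
  · exfalso; omega
  · left; exact ⟨by omega, by omega, by omega, by omega⟩
  · exfalso; omega
  · exfalso; omega

end Summit.MatrixMultiplication.MatrixMultiplication.Theorems.ObstructionCalculus
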